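import Literature.MathematicalPhysics.QuantumFieldTheory.Balaban1983to89.HaarUnitaryMaximalChart
import Literature.LinearAlgebra.AevalEigenvalueMultiplicities

/-!
# `Balaban1983to89.UnitaryLogSpectralForm` — THE SPECTRAL FORM `A = g·diag(iθ)·g*` OF `A ∈ 𝔲(N)` AND WHAT IT GIVES:
# `e^A = g·diag(e^{iθ})·g*`, `χ_{e^A} = Π_j (X − e^{iθ_j})`, `‖g·diag(d)·g*‖ = max_j |d_j|`, `‖A − icI‖ < r ↔ ∀ j, |θ_j − c| < r`,
# `tr A = iΣ_j θ_j`; simple spectrum passes through `exp` on `‖A‖ < π`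

statement-level skeleton of published theorems with citation tags; proofs where landed; nothing here is a claim
about the Yang–Mills mass gap

Mega-formalization `lit-balaban` (HOME `run/shared/lean/pub/lit-balaban/`), unit `lit-balaban-p28` gen 14 (Phase-2 proof
seat; free-target protocol G.5-34(d), TAKING 2026-08-23T03:29Z: [BrockerTomDieck1985] Ch. IV Thm. (2.11)(ii) for `U(N)`,
`SU(N)` and [Helgason2000] Thm. 1.14 (13) / [Balaban1985UV3] p. 260 GLOBALLY for `SU(N)`).  File 2 of 6 of that target
(file 1 = `Literature/LinearAlgebra/Matrix/CharpolyDiscriminantNull`; files 3–6 = `HaarRegularElementsNull` (repeated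
eigenvalue is Haar-null on `U(N)`, `SU(N)`), `SpecialUnitaryAlcove` (the alcove domain `Ω ⊆ 𝔰𝔲(N)`, `exp` injective on
it), `SpecialUnitaryPrincipalLog` (`SU(N)_reg ⊆ exp Ω`), `HaarDensitySpecialUnitaryGlobal` (the global formula)).  THIS
FILE is the shared tool-box of files 3–5: the finite-dimensional spectral calculus behind print's (22)–(23) for
`A ∈ 𝔲(N) = (unitaryLogChart N).lie` (the tree's `U(N)` chart Lie algebra, gen 8–13), with the tree's labelling of the
eigenvalues `iθ_j(A)`, `θ(A) := (isHermitian_neg_I_smul _).eigenvalues` = the eigenvalues of the Hermitian matrix `−iA`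
(`HaarDensityUnitaryExplicit`), and `g` = its `eigenvectorUnitary`.

CITATION HEADER.  [Balaban1985Averaging] T. Bałaban, *Averaging operations for lattice gauge theories*, Commun. Math.
Phys. **98** (1985) 17–51 (held `paper:doi-10-1007-bf01211042`), Sect. A, p. 21: (22) *«log X = Σ_j log z_j P_j»* and
*«Every unitary matrix U can be represented uniquely in the form U = Σ_{j=1}^r e^{iλ_j}P_j, where the numbers λ_j are
different and satisfy λ_j ∈ ]−π, π], and then we define (23) log U = iΣ_j λ_jP_j = iA, A is a hermitian matrix,
|A| ≤ π»*.  The theorems below are the spectral theorem behind this sentence in the form the lineage's exponential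
charts use it (`A` skew-Hermitian, `P_j` = the spectral projections of `g·diag(·)·g*`); [BrockerTomDieck1985] Ch. IV
(3.1) (the diagonal maximal torus of `U(n)`) for the simple-spectrum witness.

WHAT IS PROVED (theorems only; no definition, no named fact):
* §1 `exists_mem_unitaryLogChart_lie_separable` (`i·diag(0, 1, …, N−1) ∈ 𝔲(N)` has simple spectrum), **`eq_conj_diagonal`**
  (`A = g·diag(iθ(A))·g*`), **`exp_eq_conj_diagonal`** (`e^A = g·diag(e^{iθ(A)})·g*`), **`charpoly_exp_eq_prod`**
  (`χ_{e^A} = Π_j (X − e^{iθ_j(A)})`), `injective_eigenvalues_of_separable` (`χ_A` separable ⇒ `θ(A)` injective),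
  **`separable_charpoly_exp_of_norm_lt_pi`** (`‖A‖ < π` and `χ_A` separable ⇒ `χ_{e^A}` separable — print's «the numbers
  λ_j are different … λ_j ∈ ]−π, π]» read from `A` to `U = e^A`);
* §2 **`norm_conj_diagonal`** (`‖g·diag(d)·g*‖ = ‖d‖_∞`, `g` unitary), **`norm_conj_diagonal_sub_smul_one_lt_iff`** and
  **`norm_sub_smul_one_lt_iff`** (`‖g·diag(iθ)·g* − icI‖ < r ↔ ∀ j, |θ_j − c| < r`; for `A ∈ 𝔲(N)` with `θ = θ(A)`),
  `trace_eq_I_mul_sum_eigenvalues` (`tr A = iΣ_j θ_j(A)`).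

HONEST SCOPE.  (i) Finite index types only (`M_N(ℂ)`); the norm is the lineage's `L²`-operator norm (scope
`Matrix.Norms.L2Operator`), for which `‖diag(d)‖ = ‖d‖_∞` (Mathlib `Matrix.l2_opNorm_diagonal`).  (ii) Print's
UNIQUENESS in (22) and the closed window `λ_j ∈ ]−π, π]`, `|A| ≤ π` are not restated: the lineage's charts use the open
window `‖A‖ < π` (gen 13 `HaarDensityUnitaryGlobal.injOn_expChart_ball_pi`) and, for `SU(N)`, the re-centred open
windows of `SpecialUnitaryAlcove`; the principal logarithm as a function is not defined here.  (iii) Nothing of gen 8–13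
or Mathlib is re-proved; the eigenvalue labelling and the eigenvector unitary are Mathlib's (`Matrix.IsHermitian`).
Failed printed steps: none (HOME/GAPS.md unchanged).

## References
* T. Bałaban, *Averaging operations for lattice gauge theories*, Commun. Math. Phys. **98** (1985) 17–51, (22)–(23)
  p. 21. [Balaban1985Averaging]
* Th. Bröcker, T. tom Dieck, *Representations of Compact Lie Groups*, GTM 98, Springer (1985), Ch. IV (3.1).
  [BrockerTomDieck1985]
-/


noncomputable section

open NormedSpace Set Function Filter Topology MeasureTheory Complex Polynomial
open scoped ENNReal NNReal Matrix.Norms.L2Operator ComplexConjugate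

namespace Literature.MathematicalPhysics.QuantumFieldTheory.Balaban1983to89.UnitaryLogSpectralForm

variable {n : Type*} [Fintype n] [DecidableEq n]

open HaarExponentialChart HaarExponentialChart.IsChartRep HaarDensityUnitaryGlobal
open HaarDensityUnitaryChart (conjTranspose_eq_neg_of_mem_unitaryLogChart)
open HaarDensityUnitaryExplicit (isHermitian_neg_I_smul roots_charpoly_eq_of_skewHermitian)

/-! ## §1 The spectral form of `A ∈ 𝔲(N)`, of `e^A`, of `χ_{e^A}`; simple spectrum through the chart on `‖A‖ < π` -/

/-- A WITNESS OF SIMPLE SPECTRUM IN `𝔲(N)`: the diagonal matrix `i·diag(0, 1, …, N−1)` (in any enumeration of the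
index type) is skew-adjoint with `N` distinct eigenvalues. [cite: BrockerTomDieck1985, Ch. IV (3.1) (the diagonal
maximal torus of U(n))] -/
theorem exists_mem_unitaryLogChart_lie_separable :
    ∃ A ∈ (unitaryLogChart n).lie, A.charpoly.Separable := by
  classical
  let e : n ≃ Fin (Fintype.card n) := Fintype.equivFin n
  let d : n → ℂ := fun j => I * ((e j : ℕ) : ℂ)
  refine ⟨Matrix.diagonal d, ?_, ?_⟩
  · rw [mem_unitaryLogChart_lie, Matrix.star_eq_conjTranspose, Matrix.diagonal_conjTranspose, Matrix.diagonal_neg]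
    congr 1
    funext j
    simp [d]
  · rw [Matrix.charpoly_diagonal, separable_prod_X_sub_C_iff]
    intro j k hjk
    have h1 : ((e j : ℕ) : ℂ) = ((e k : ℕ) : ℂ) := mul_left_cancel₀ I_ne_zero hjk
    exact e.injective (Fin.ext (by exact_mod_cast h1))

/-- For `A ∈ 𝔲(N)` with eigenvalues `iθ_j` (`θ` = the eigenvalues of the Hermitian `−iA`):
`A = U · diag(iθ) · U*` with `U` the eigenvector unitary of `−iA` (print's «U = Σ_j e^{iλ_j}P_j … log U = iΣ_j λ_jP_j = iA, A
hermitian», the spectral form of `A`). [cite: Balaban1985Averaging, (22)–(23) p. 21] -/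
theorem eq_conj_diagonal (A : (unitaryLogChart n).lie) :
    (A : Matrix n n ℂ) =
      ((isHermitian_neg_I_smul (conjTranspose_eq_neg_of_mem_unitaryLogChart A)).eigenvectorUnitary : Matrix n n ℂ) *
        Matrix.diagonal (fun j => I *
          ((isHermitian_neg_I_smul (conjTranspose_eq_neg_of_mem_unitaryLogChart A)).eigenvalues j : ℂ)) *
        star ((isHermitian_neg_I_smul (conjTranspose_eq_neg_of_mem_unitaryLogChart A)).eigenvectorUnitary :
          Matrix n n ℂ) := by
  set hH := isHermitian_neg_I_smul (conjTranspose_eq_neg_of_mem_unitaryLogChart A)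
  have hspec := hH.spectral_theorem
  rw [Unitary.conjStarAlgAut_apply] at hspec
  have hA : (A : Matrix n n ℂ) = I • ((-I) • (A : Matrix n n ℂ)) := by
    rw [smul_smul, mul_neg, I_mul_I, neg_neg, one_smul]
  conv_lhs => rw [hA, hspec]
  rw [← Matrix.smul_mul, ← Matrix.mul_smul, ← Matrix.diagonal_smul]
  congr 2

/-- `e^A = U · diag(e^{iθ_j}) · U*` for `A ∈ 𝔲(N)` (print's «U = Σ_j e^{iλ_j}P_j» for `U = e^A`, `log U = iA`).
[cite: Balaban1985Averaging, (22)–(23) p. 21] -/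
theorem exp_eq_conj_diagonal (A : (unitaryLogChart n).lie) :
    NormedSpace.exp (A : Matrix n n ℂ) =
      ((isHermitian_neg_I_smul (conjTranspose_eq_neg_of_mem_unitaryLogChart A)).eigenvectorUnitary : Matrix n n ℂ) *
        Matrix.diagonal (fun j => cexp (I *
          ((isHermitian_neg_I_smul (conjTranspose_eq_neg_of_mem_unitaryLogChart A)).eigenvalues j : ℂ))) *
        star ((isHermitian_neg_I_smul (conjTranspose_eq_neg_of_mem_unitaryLogChart A)).eigenvectorUnitary :
          Matrix n n ℂ) := by
  letI : NormedAlgebra ℚ (Matrix n n ℂ) := NormedAlgebra.restrictScalars ℚ ℂ _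
  set hH := isHermitian_neg_I_smul (conjTranspose_eq_neg_of_mem_unitaryLogChart A)
  set U : Matrix n n ℂ := (hH.eigenvectorUnitary : Matrix n n ℂ) with hU
  have hUu : U ∈ Matrix.unitaryGroup n ℂ := hH.eigenvectorUnitary.2
  have hUunit : IsUnit U := ⟨⟨U, star U, (Matrix.mem_unitaryGroup_iff).1 hUu, (Matrix.mem_unitaryGroup_iff').1 hUu⟩, rfl⟩
  have hinv : U⁻¹ = star U := Matrix.inv_eq_right_inv ((Matrix.mem_unitaryGroup_iff).1 hUu)
  conv_lhs => rw [eq_conj_diagonal A]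
  rw [← hU, ← hinv, Matrix.exp_conj U _ hUunit, Matrix.exp_diagonal, Pi.exp_def, exp_eq_exp_ℂ]

/-- The characteristic polynomial of `e^A`, `A ∈ 𝔲(N)`: `χ_{e^A} = Π_j (X − e^{iθ_j})` (the eigenvalues `e^{iλ_j}` of
print's (22)). [cite: Balaban1985Averaging, (22)–(23) p. 21] -/
theorem charpoly_exp_eq_prod (A : (unitaryLogChart n).lie) :
    (NormedSpace.exp (A : Matrix n n ℂ)).charpoly = ∏ j, (X - C (cexp (I *
      ((isHermitian_neg_I_smul (conjTranspose_eq_neg_of_mem_unitaryLogChart A)).eigenvalues j : ℂ)))) := by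
  conv_lhs => rw [exp_eq_conj_diagonal A, Matrix.mul_assoc, Matrix.charpoly_mul_comm, Matrix.mul_assoc,
    Matrix.mem_unitaryGroup_iff'.1 (isHermitian_neg_I_smul (conjTranspose_eq_neg_of_mem_unitaryLogChart A)).eigenvectorUnitary.2,
    Matrix.mul_one, Matrix.charpoly_diagonal]

/-- The eigenvalue function `θ` of `A ∈ 𝔲(N)` is injective when `χ_A` is separable («the numbers λ_j are different»).
[cite: Balaban1985Averaging, (22) p. 21] -/
theorem injective_eigenvalues_of_separable (A : (unitaryLogChart n).lie) (hsep : (A : Matrix n n ℂ).charpoly.Separable) :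
    Function.Injective (isHermitian_neg_I_smul (conjTranspose_eq_neg_of_mem_unitaryLogChart A)).eigenvalues := by
  set hH := isHermitian_neg_I_smul (conjTranspose_eq_neg_of_mem_unitaryLogChart A)
  have hnd : (A : Matrix n n ℂ).charpoly.roots.Nodup :=
    (nodup_roots_iff_of_splits (Matrix.charpoly_monic _).ne_zero (IsAlgClosed.splits _)).2 hsep
  rw [roots_charpoly_eq_of_skewHermitian (conjTranspose_eq_neg_of_mem_unitaryLogChart A),
    Multiset.nodup_map_iff_inj_on Finset.univ.nodup] at hnd
  intro j k hjk
  exact hnd j (Finset.mem_univ _) k (Finset.mem_univ _) (by rw [hjk])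

/-- **SIMPLE SPECTRUM PASSES THROUGH THE CHART ON `‖A‖ < π`**: for `A ∈ 𝔲(N)` with `‖A‖ < π` and `χ_A` separable,
`χ_{e^A}` is separable (`e^{iθ_j} = e^{iθ_k}` with `|θ_j|, |θ_k| ≤ ‖A‖ < π` forces `θ_j = θ_k`).
[cite: Balaban1985Averaging, (22)–(23) p. 21] -/
theorem separable_charpoly_exp_of_norm_lt_pi (A : (unitaryLogChart n).lie) (hA : ‖A‖ < Real.pi)
    (hsep : (A : Matrix n n ℂ).charpoly.Separable) : (NormedSpace.exp (A : Matrix n n ℂ)).charpoly.Separable := by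
  set hH := isHermitian_neg_I_smul (conjTranspose_eq_neg_of_mem_unitaryLogChart A)
  have hinj := injective_eigenvalues_of_separable A hsep
  rw [charpoly_exp_eq_prod A, separable_prod_X_sub_C_iff]
  intro j k hjk
  haveI : Nonempty n := ⟨j⟩
  obtain ⟨m, hm⟩ := Complex.exp_eq_exp_iff_exists_int.1 hjk
  have hjb := abs_eigenvalue_le_norm A j
  have hkb := abs_eigenvalue_le_norm A k
  have hreal : (hH.eigenvalues j : ℝ) = hH.eigenvalues k + m * (2 * Real.pi) := by
    have h1 : I * (hH.eigenvalues j : ℂ) = I * ((hH.eigenvalues k : ℂ) + (m : ℂ) * (2 * Real.pi)) := by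
      rw [hm]; ring
    have h2 := mul_left_cancel₀ I_ne_zero h1
    exact_mod_cast h2
  have hm0 : m = 0 := by
    rw [abs_le] at hjb hkb
    have hlt : |(m : ℝ)| < 1 := by
      rw [abs_lt]
      constructor <;> nlinarith [Real.pi_pos]
    have : |m| < 1 := by exact_mod_cast hlt
    exact Int.abs_lt_one_iff.1 this
  apply hinj
  rw [hreal, hm0]
  simp

/-! ## §2 Unitary conjugates of diagonal matrices: norm, scalar shift, trace -/

/-- `‖g · diag(d) · g*‖ = max_j |d_j|` for unitary `g` (`L²`-operator norm; `‖d‖` = the sup norm of `d : n → ℂ`): the norm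
of the normal matrix `Σ_j d_j P_j` of print's (22). [cite: Balaban1985Averaging, (22)–(23) p. 21] -/
theorem norm_conj_diagonal {g : Matrix n n ℂ} (hg : g ∈ Matrix.unitaryGroup n ℂ) (d : n → ℂ) :
    ‖g * Matrix.diagonal d * star g‖ = ‖d‖ := by
  have h1 : ‖((⟨g, hg⟩ : Matrix.unitaryGroup n ℂ) : Matrix n n ℂ) * (Matrix.diagonal d * star g)‖ =
      ‖Matrix.diagonal d * star g‖ := CStarRing.norm_coe_unitary_mul ⟨g, hg⟩ _
  have h2 : ‖Matrix.diagonal d * star ((⟨g, hg⟩ : Matrix.unitaryGroup n ℂ) : Matrix n n ℂ)‖ = ‖Matrix.diagonal d‖ := by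
    rw [← Unitary.coe_star]
    exact CStarRing.norm_mul_coe_unitary _ _
  rw [Matrix.mul_assoc]
  exact h1.trans (h2.trans (Matrix.l2_opNorm_diagonal d))

omit [DecidableEq n] in
/-- `‖(i t_j)_j‖ < r ↔ ∀ j, |t_j| < r` for the sup norm (`r > 0`). [folklore] -/
private theorem norm_I_mul_lt_iff (t : n → ℝ) {r : ℝ} (hr : 0 < r) :
    ‖(fun j => I * (t j : ℂ))‖ < r ↔ ∀ j, |t j| < r := by
  rw [pi_norm_lt_iff hr]
  refine forall_congr' fun j => ?_
  rw [norm_mul, Complex.norm_I, one_mul, Complex.norm_real, Real.norm_eq_abs]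

omit [Fintype n] in
/-- The scalar matrix `(ic)·1` is the diagonal matrix with entries `ic`. [folklore] -/
private theorem smul_one_eq_diagonal (k : ℂ) : k • (1 : Matrix n n ℂ) = Matrix.diagonal fun _ : n => k := by
  ext i j
  rw [Matrix.smul_apply, Matrix.one_apply, Matrix.diagonal_apply]
  split_ifs <;> simp

/-- `g · diag(iθ) · g* − icI = g · diag(i(θ − c)) · g*` for unitary `g`. [folklore] -/
private theorem conj_diagonal_sub_smul_one {g : Matrix n n ℂ} (hg : g ∈ Matrix.unitaryGroup n ℂ) (θ : n → ℝ) (c : ℝ) :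
    g * Matrix.diagonal (fun j => I * (θ j : ℂ)) * star g - ((c : ℂ) * I) • (1 : Matrix n n ℂ) =
      g * Matrix.diagonal (fun j => I * ((θ j - c : ℝ) : ℂ)) * star g := by
  have hgg : g * star g = 1 := Matrix.mem_unitaryGroup_iff.1 hg
  have hK : ((c : ℂ) * I) • (1 : Matrix n n ℂ) = g * (((c : ℂ) * I) • (1 : Matrix n n ℂ)) * star g := by
    rw [Matrix.mul_smul, Matrix.mul_one, Matrix.smul_mul, hgg]
  conv_lhs => rw [hK]
  rw [← Matrix.sub_mul, ← Matrix.mul_sub, smul_one_eq_diagonal, Matrix.diagonal_sub]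
  exact congrArg (fun d : n → ℂ => g * Matrix.diagonal d * star g) (funext fun j => by push_cast; ring)

/-- **THE NORM OF `g·diag(iθ)·g* − icI` IS `max_j |θ_j − c|`**: `‖g·diag(iθ)·g* − icI‖ < r ↔ ∀ j, |θ_j − c| < r`
(`r > 0`, `g` unitary). [cite: Balaban1985Averaging, (22)–(23) p. 21] -/
theorem norm_conj_diagonal_sub_smul_one_lt_iff {g : Matrix n n ℂ} (hg : g ∈ Matrix.unitaryGroup n ℂ) (θ : n → ℝ)
    (c : ℝ) {r : ℝ} (hr : 0 < r) :
    ‖g * Matrix.diagonal (fun j => I * (θ j : ℂ)) * star g - ((c : ℂ) * I) • (1 : Matrix n n ℂ)‖ < r ↔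
      ∀ j, |θ j - c| < r := by
  rw [conj_diagonal_sub_smul_one hg θ c, norm_conj_diagonal hg, norm_I_mul_lt_iff _ hr]

/-- For `A ∈ 𝔲(N)` with eigenvalues `iθ_j`: **`‖A − icI‖ < r ↔ ∀ j, |θ_j − c| < r`** (`r > 0`).
[cite: Balaban1985Averaging, (22)–(23) p. 21] -/
theorem norm_sub_smul_one_lt_iff (A : (unitaryLogChart n).lie) (c : ℝ) {r : ℝ} (hr : 0 < r) :
    ‖(A : Matrix n n ℂ) - ((c : ℂ) * I) • (1 : Matrix n n ℂ)‖ < r ↔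
      ∀ j, |(isHermitian_neg_I_smul (conjTranspose_eq_neg_of_mem_unitaryLogChart A)).eigenvalues j - c| < r := by
  conv_lhs => rw [eq_conj_diagonal A]
  exact norm_conj_diagonal_sub_smul_one_lt_iff
    (isHermitian_neg_I_smul (conjTranspose_eq_neg_of_mem_unitaryLogChart A)).eigenvectorUnitary.2 _ c hr

/-- For `A ∈ 𝔲(N)`: `tr A = i Σ_j θ_j`. [cite: Balaban1985Averaging, (22)–(23) p. 21] -/
theorem trace_eq_I_mul_sum_eigenvalues (A : (unitaryLogChart n).lie) :
    (A : Matrix n n ℂ).trace =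
      I * ∑ j, ((isHermitian_neg_I_smul (conjTranspose_eq_neg_of_mem_unitaryLogChart A)).eigenvalues j : ℂ) := by
  have h := (isHermitian_neg_I_smul (conjTranspose_eq_neg_of_mem_unitaryLogChart A)).trace_eq_sum_eigenvalues
  rw [Matrix.trace_smul, smul_eq_mul] at h
  have h2 : (A : Matrix n n ℂ).trace = I * ((-I) * (A : Matrix n n ℂ).trace) := by
    rw [← mul_assoc, mul_neg, I_mul_I, neg_neg, one_mul]
  rw [h2, h]
  rfl

end Literature.MathematicalPhysics.QuantumFieldTheory.Balaban1983to89.UnitaryLogSpectralForm
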